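import Summits.ResolutionOfSingularities.ResolutionOfSingularities.Theorems.FrobeniusClosingPatchingRelPerfectDepthSepCJSPieceStep
import Summits.ResolutionOfSingularities.ResolutionOfSingularities.Theorems.FrobeniusClosingPatchingRelPerfectDepthWeightTwoBEnd
import Summits.ResolutionOfSingularities.ResolutionOfSingularities.Theorems.FrobeniusClosingPatchingRelPerfectDepthSepPeelStep
import Summits.ResolutionOfSingularities.ResolutionOfSingularities.Theorems.FrobeniusClosingPatchingRelPerfectDepthOneDivisorialFactorization
import Summits.ResolutionOfSingularities.ResolutionOfSingularities.Theorems.FrobeniusClosingPatchingRelPerfectDepthOneRegularizeSupportEnd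
import Literature.AlgebraicGeometry.Resolution.DivisorialPart
import Literature.AlgebraicGeometry.Resolution.PrimeDivisorIdeals
import Literature.AlgebraicGeometry.Resolution.AlterationsMultisectionLocalStepProofs
import Literature.AlgebraicGeometry.Resolution.KollarNmPartBlowup
import Literature.AlgebraicGeometry.Resolution.KollarBoundaryCentre
import HarnessLib

/-!
# Crux `PatchingRelPerfect` (stmt-ResolutionOfSingularities-16161), chain W5.2 — F6 STAGE 2, target T6-E2 `SeparationBoundaryNil₃`,
# PHASE A: the END — the MID datum handed to Phase B (res-L1-w52-stub-1's «PEEL-ALL»)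

[OURS · L1 W5.2 · TargetsF6 T6-E2 Phase A] Fact-free; NOT statements of the manuscript under review (Hironaka 2017).  From the
Phase-A transport state `SepCJS.StateA 𝔟' H' ℬ' 𝒟'` on `E₁ ≅ Z₁` at the END of the Cossart–Jannsen–Saito sequence — `Supp H'`
the preimage of the (closed) strict transform `X₁`, whose reduced structure is REGULAR, the born traces over the boundary `B₁`,
and `X₁` TRANSVERSAL to `B₁` (the end clauses of F-32bR) — `StateA.endData` produces the MID datum of res-L1-w52-stub-1's interface
(10:15:31Z / 10:24:27Z): an snc list `𝓔₀` and an exponent list `𝒮` with `monomialIdeal 𝒮 = 𝔟'`, every member of `𝒮` in `𝓔₀`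
with (pre)connected support, and every trace of the format's list `𝒟'` in `𝓔₀`.  Construction:
* `𝒮 = 𝒮_H ++ ℬ'`, `𝒮_H = [(𝓘(cl{ζ}), ord_ζ H')]` over the codimension-one points `ζ` of `V(H')` — the divisorial factorisation
  of the locally principal `H'` (tree `DivisorialPart`: `divisorialPart_mul_codimTwoPart`, `isLocallyPrincipal_iff_codimTwoPart_eq_top`,
  as in res-D-pv-054's `DepthCleanup.exists_monomial_presentation`), so `monomialIdeal 𝒮 = H' · monomialIdeal ℬ' = 𝔟'`;
* `𝓔₀ = boundaryOf 𝒮`, snc POINTWISE: off `Supp H'` only traces pass (`StateA.sncB`); at `x ∈ Supp H'` the born traces are snc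
  WITH the reduced host `𝓘(Supp H')` (res-type-019's P3 through `e`, `WeightTwoB.hasSNCWith_comap_of_isNormalCrossingWith`), the
  reduced host is a regular hypersurface there — its stalk is that of the prime divisor `𝓘(cl{ζ})` through `x` (a piece of the
  regular `V(𝓘(Supp H'))`, `stalkIdeal_centrePiece_eq`), an effective Cartier divisor with regular zero-scheme
  (`isEffectiveCartier_primeDivisorIdeal_of_isRegular`, `DepthOne.isRegular_subscheme_primeDivisorIdeal_of_ne_univ`) — and no trace
  has the host's stalk inside its own (`StateA.not_stalkIdeal_le_host`, from `free`), whence `SNCWithAt (𝓘(cl{ζ}) :: boundaryOf ℬ') ⊤ x`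
  by res-type-049's exchange lemma `SNCWithAt.host_cons_transversal` and res-L1-w52-stub-1's head swap
  `DepthSep.sncWithAt_cons_of_stalkIdeal_eq`; the other prime divisors of `H'` miss `x` (UNIQUENESS of the codimension-one point
  of the regular `Supp H'` specialising to `x`: pieces are disjoint), so `SNCWithAt.anti` finishes.

AI-written; AI review is weaker than expert review.

## References
* V. Cossart, U. Jannsen, S. Saito, LNM 2270 (2020), Thm. 1.4, Cor. 1.5 (p. 7: `X₁` regular, `B₁` snc, `X₁ ⋔ B₁`). [CossartJannsenSaito2020]
* V. Cossart, O. Piltant, J. Algebra 320 (2008), proof of Prop. 4.2 (divisorial part of a principal ideal). [CossartPiltant2008]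
* J. Kollár, *Lectures on Resolution of Singularities* (2007), Def. 3.24–3.25, 3.30.2. [Kollar2007]
* The Stacks Project, Tags 0357, 0BE1, 0BIA. [StacksProject]
-/

-- `Summit.<Summit>.<Sub>.Theorems` with `Sub = Summit` (single-conjunct summit, D-0017)
set_option linter.dupNamespace false

noncomputable section

open CategoryTheory CategoryTheory.Limits AlgebraicGeometry TopologicalSpace IsLocalRing
open Literature.AlgebraicGeometry.Resolution Scheme.IdealSheafData
open Literature.AlgebraicGeometry.Hironaka2017.MonomialPart Literature.AlgebraicGeometry.Hironaka2017.MonomialComponent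

namespace Summit.ResolutionOfSingularities.ResolutionOfSingularities.Theorems

universe u

namespace SepCJS

open DepthSNC WeightTwoB

variable {E₁ : Scheme.{u}} [IsIntegral E₁] [IsNoetherian E₁]
  {𝔟' H' : E₁.IdealSheafData} {ℬ' 𝒟' : List (E₁.IdealSheafData × ℕ)}

/-! ## Stalk facts of the state -/

/-- The host is non-zero (an effective Cartier divisor on an integral scheme has dense complement of support). [folklore] -/
theorem StateA.host_ne_bot (S : StateA 𝔟' H' ℬ' 𝒟') : H' ≠ ⊥ := by
  intro h0
  have hdense := S.hostCartier.dense_compl_support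
  rw [h0, Scheme.IdealSheafData.support_bot] at hdense
  have := hdense.nonempty
  simp at this

/-- **No born trace has the host's stalk inside its own at a common point**: it would put the generic point of the trace's
irreducible support on the host (`StateA.free`). [cite: Kollar2007, 3.30.2] -/
theorem StateA.not_stalkIdeal_le_host (S : StateA 𝔟' H' ℬ' 𝒟') {p : E₁.IdealSheafData × ℕ} (hp : p ∈ ℬ') {x : E₁}
    (hxB : x ∈ p.1.support) (hxD : x ∈ H'.support) :
    ¬ stalkIdeal p.1 x ≤ stalkIdeal (vanishingIdeal H'.support) x := by
  haveI := S.regW x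
  haveI := isDomain_of_isRegularLocalRing (E₁.presheaf.stalk x)
  intro hle
  obtain ⟨ξ, hξ⟩ := QuasiSober.sober (S.irred p hp) p.1.support.isClosed
  have hξx : ξ ⤳ x := hξ.specializes hxB
  have hBmem : p.1 ∈ boundaryOf ℬ' := List.mem_map.mpr ⟨p, hp, rfl⟩
  -- the stalk of the member at `x` is the prime of `ξ`
  have hBx : stalkIdeal p.1 x = primeOfSpecializes hξx := by
    have hcl : p.1.support = ⟨closure {ξ}, isClosed_closure⟩ := Closeds.ext hξ.symm
    rw [← S.sncB.vanishingIdeal_support hBmem, hcl, stalkIdeal_vanishingIdeal_closure hξx]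
  -- generators: `B_x = (u)` with `u` prime, `H'_x = (g)` with `g ∈ 𝔪`; `𝓘(Supp H')_x = √(g)`
  obtain ⟨u, hu0, hu⟩ := (S.sncB.isEffectiveCartier_of_mem hBmem).exists_stalkIdeal_eq_span x
  obtain ⟨g, -, hg⟩ := S.hostCartier.exists_stalkIdeal_eq_span x
  have hgm : g ∈ maximalIdeal (E₁.presheaf.stalk x) := by
    have h := (mem_support_iff_stalkIdeal_le H' x).mp hxD
    rw [hg, Ideal.span_singleton_le_iff_mem] at h
    exact h
  haveI hprime : (primeOfSpecializes hξx).IsPrime := Ideal.IsPrime.comap _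
  have huprime : Prime u := by
    rw [← Ideal.span_singleton_prime (nonZeroDivisors.ne_zero hu0), ← hu, hBx]; exact hprime
  -- `u ∈ √(g)`: `g ∣ u ^ n`; an irreducible factor `q` of the non-unit `g` divides `u`, so `q ~ u` and `u ∣ g`
  have hrad : stalkIdeal (vanishingIdeal H'.support) x = (Ideal.span {g}).radical := by
    rw [Scheme.IdealSheafData.vanishingIdeal_support, stalkIdeal_radical, hg]
  have humem : u ∈ (Ideal.span {g} : Ideal (E₁.presheaf.stalk x)).radical := by
    rw [← hrad]; exact hle (hu ▸ Ideal.mem_span_singleton_self u)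
  obtain ⟨n, hn⟩ := humem
  have hgdvd : g ∣ u ^ n := Ideal.mem_span_singleton.mp hn
  have hgnu : ¬ IsUnit g := fun hunit => (maximalIdeal.isMaximal _).ne_top (Ideal.eq_top_of_isUnit_mem _ hgm hunit)
  have hg0 : g ≠ 0 := by
    rintro rfl
    rw [zero_dvd_iff] at hgdvd
    rcases Nat.eq_zero_or_pos n with rfl | hn0
    · rw [pow_zero] at hgdvd
      exact one_ne_zero (α := E₁.presheaf.stalk x) hgdvd
    · exact huprime.ne_zero ((pow_eq_zero_iff hn0.ne').mp hgdvd)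
  haveI := IsRegularLocalRing.uniqueFactorizationMonoid (E₁.presheaf.stalk x)
  obtain ⟨q, hq, hqg⟩ := WfDvdMonoid.exists_irreducible_factor hgnu hg0
  have hqu : q ∣ u := hq.prime.dvd_of_dvd_pow (hqg.trans hgdvd)
  have hug : u ∣ g := (hq.associated_of_dvd huprime.irreducible hqu).symm.dvd.trans hqg
  have hDξ : stalkIdeal H' x ≤ primeOfSpecializes hξx := by
    rw [← hBx, hu, hg]; exact Ideal.span_singleton_le_span_singleton.mpr hug
  have hξD : ξ ∈ H'.support := (mem_support_iff_stalkIdeal_le_primeOfSpecializes hξx H').mpr hDξ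
  refine S.free p hp ?_
  rw [← hξ]
  exact closure_minimal (Set.singleton_subset_iff.mpr hξD) H'.support.isClosed

/-! ## The codimension-one points of the host -/

/-- A point of `Supp H'` specialises from a codimension-ONE point of `Supp H'` (Krull). [cite: StacksProject, Tag 0BE1] -/
theorem StateA.exists_divisorialPoint_specializes (S : StateA 𝔟' H' ℬ' 𝒟') {x : E₁} (hx : x ∈ H'.support) :
    ∃ ζ ∈ divisorialPoints H', ζ ⤳ x := by
  obtain ⟨ξ, hξsupp, hξx, hξco⟩ := S.hostCartier.exists_specializes_coheight_le_one hx
  have hξ0 : Order.coheight ξ ≠ 0 := fun h0 =>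
    not_mem_support_genericPoint S.host_ne_bot (eq_genericPoint_of_coheight_eq_zero h0 ▸ hξsupp)
  exact ⟨ξ, (mem_divisorialPoints_iff H' ξ).mpr ⟨hξsupp, le_antisymm hξco (Order.one_le_iff_ne_zero.mpr hξ0)⟩, hξx⟩

/-- The support of the host is a proper closed subset. [folklore] -/
theorem StateA.support_host_ne_univ (S : StateA 𝔟' H' ℬ' 𝒟') : (H'.support : Set E₁) ≠ Set.univ := fun h =>
  not_mem_support_genericPoint S.host_ne_bot (show genericPoint E₁ ∈ (H'.support : Set E₁) from h ▸ Set.mem_univ _)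

/-- The prime divisor through a codimension-one point of `Supp H'` is a piece of `V(𝓘(Supp H'))`. [cite: StacksProject, Tag 0BE1] -/
theorem StateA.closure_mem_boundaryPieces (S : StateA 𝔟' H' ℬ' 𝒟') {ζ : E₁} (hζ : ζ ∈ divisorialPoints H') :
    (⟨closure {ζ}, isClosed_closure⟩ : Closeds E₁) ∈ Kollar2007.boundaryPieces (vanishingIdeal H'.support) := by
  rw [mem_divisorialPoints_iff] at hζ
  rw [Kollar2007.mem_boundaryPieces_iff, Scheme.IdealSheafData.coe_support_vanishingIdeal]
  exact DepthOne.closure_singleton_mem_componentsIn hζ.2 H'.support.isClosed S.support_host_ne_univ hζ.1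

/-- **Uniqueness of the codimension-one point of the REGULAR `Supp H'` specialising to a given point** (the pieces of a regular
closed subscheme are pairwise disjoint). [cite: StacksProject, Tag 0357] -/
theorem StateA.divisorialPoint_unique (S : StateA 𝔟' H' ℬ' 𝒟')
    (hreg : Scheme.IsRegular (vanishingIdeal H'.support).subscheme) {ζ ζ' x : E₁} (hζ : ζ ∈ divisorialPoints H')
    (hζ' : ζ' ∈ divisorialPoints H') (hx : ζ ⤳ x) (hx' : ζ' ⤳ x) : ζ = ζ' := by
  have hP := isPiecePartition_boundaryPieces_of_isRegular hreg
  have heq := hP.eq_of_mem (S.closure_mem_boundaryPieces hζ) (S.closure_mem_boundaryPieces hζ')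
    (specializes_iff_mem_closure.mp hx) (specializes_iff_mem_closure.mp hx')
  have heq' : closure ({ζ} : Set E₁) = closure {ζ'} := congrArg (fun Z : Closeds E₁ => (Z : Set E₁)) heq
  exact (isGenericPoint_closure (x := ζ)).eq (heq' ▸ isGenericPoint_closure (x := ζ'))

/-! ## The END -/

/-- **THE END OF PHASE A** (see the module docstring): the MID datum `(𝓔₀, 𝒮)` of res-L1-w52-stub-1's Phase-B interface, from the
CJS end clauses read through `e : E₁ ≅ Z₁`. [cite: CossartJannsenSaito2020, Thm. 1.4, Cor. 1.5 (p. 7)] [cite: CossartPiltant2008, Prop. 4.2]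
[cite: Kollar2007, Def. 3.25] -/
theorem StateA.endData {Z₁ : Scheme.{u}} [IsLocallyNoetherian Z₁] (S : StateA 𝔟' H' ℬ' 𝒟') (e : E₁ ≅ Z₁) {X₁ B₁ : Set Z₁}
    (hX₁c : IsClosed X₁) (hX₁ : Scheme.IsRegular (vanishingIdeal ⟨closure X₁, isClosed_closure⟩).subscheme)
    (htr : IsTransversalWith Z₁ X₁ B₁) (hsupp : (H'.support : Set E₁) = e.hom ⁻¹' closure X₁)
    (hbd : ∀ p ∈ ℬ', (p.1.support : Set E₁) ⊆ e.hom ⁻¹' B₁) :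
    ∃ (𝓔₀ : List E₁.IdealSheafData) (𝒮 : List (E₁.IdealSheafData × ℕ)),
      HasSNC 𝓔₀ ∧ (∀ p ∈ 𝒮, p.1 ∈ 𝓔₀ ∧ _root_.IsPreconnected (p.1.support : Set E₁)) ∧
      (∀ D ∈ boundaryOf 𝒟', D ∈ 𝓔₀ ∨ D = ⊤) ∧ monomialIdeal 𝒮 = 𝔟' := by
  classical
  set T : Closeds Z₁ := ⟨closure X₁, isClosed_closure⟩ with hT
  set D : E₁.IdealSheafData := vanishingIdeal H'.support with hDdef
  -- the reduced host IS the pulled-back reduced ideal of `cl X₁`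
  have hD : D = (vanishingIdeal T).comap e.hom := by
    rw [comap_hom_vanishingIdeal, hDdef]
    congr 1
    exact Closeds.ext hsupp
  have hDreg : Scheme.IsRegular D.subscheme := by
    rw [hD]; exact isRegular_subscheme_comap_of_isOpenImmersion e.hom _ hX₁
  -- the born traces are snc WITH the reduced host (P3 on `Z₁` through `e`)
  have hTsupp : ((vanishingIdeal T).support : Set Z₁) = closure X₁ := Scheme.IdealSheafData.coe_support_vanishingIdeal T
  have hnc : IsNormalCrossingWith Z₁ ((vanishingIdeal T).support : Set Z₁) B₁ := by
    rw [hTsupp, hX₁c.closure_eq]; exact htr.isNormalCrossingWith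
  have hℬD : HasSNCWith (boundaryOf ℬ') D := by
    rw [hD]
    refine hasSNCWith_comap_of_isNormalCrossingWith e S.sncB (fun K hK => ?_) ?_ hnc
    · obtain ⟨p, hp, rfl⟩ := List.mem_map.mp hK
      exact hbd p hp
    · have hs : (vanishingIdeal T).support = T := Closeds.ext (Scheme.IdealSheafData.coe_support_vanishingIdeal T)
      rw [hs]
  -- the divisorial factorisation of the host
  have hfin : (divisorialPoints H').Finite := finite_divisorialPoints S.host_ne_bot
  have hJ : codimTwoPart H' = ⊤ :=
    (isLocallyPrincipal_iff_codimTwoPart_eq_top S.regW S.host_ne_bot).mp S.hostCartier.isLocallyPrincipal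
  have hHeq : H' = ∏ ζ ∈ hfin.toFinset, primeDivisorIdeal ζ ^ (idealOrder H' ζ).toNat := by
    have h := divisorialPart_mul_codimTwoPart S.regW S.host_ne_bot
    rw [hJ, Scheme.IdealSheafData.mul_top, divisorialPart_eq hfin] at h
    exact h.symm
  set 𝒮H : List (E₁.IdealSheafData × ℕ) :=
    hfin.toFinset.toList.map fun ζ => (primeDivisorIdeal ζ, (idealOrder H' ζ).toNat) with h𝒮H
  have h𝒮Hmon : monomialIdeal 𝒮H = H' := by
    rw [h𝒮H, monomialIdeal, List.map_map, Finset.prod_map_toList]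
    exact hHeq.symm
  have hmem𝒮H : ∀ {K : E₁.IdealSheafData}, K ∈ boundaryOf 𝒮H ↔ ∃ ζ ∈ divisorialPoints H', K = primeDivisorIdeal ζ := by
    intro K
    simp only [h𝒮H, boundaryOf, List.map_map, List.mem_map, Finset.mem_toList, Set.Finite.mem_toFinset,
      Function.comp_apply]
    constructor
    · rintro ⟨ζ, hζ, rfl⟩; exact ⟨ζ, hζ, rfl⟩
    · rintro ⟨ζ, hζ, rfl⟩; exact ⟨ζ, hζ, rfl⟩
  -- no prime divisor of the host is a born trace
  have hHℬ : ∀ {ζ}, ζ ∈ divisorialPoints H' → primeDivisorIdeal ζ ∉ boundaryOf ℬ' := by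
    intro ζ hζ hmem
    obtain ⟨p, hp, hpζ⟩ := List.mem_map.mp hmem
    refine S.free p hp ?_
    rw [hpζ, coe_support_primeDivisorIdeal]
    exact closure_minimal (Set.singleton_subset_iff.mpr ((mem_divisorialPoints_iff H' ζ).mp hζ).1) H'.support.isClosed
  refine ⟨boundaryOf 𝒮H ++ boundaryOf ℬ', 𝒮H ++ ℬ', hasSNCWith_of_forall_sncWithAt fun x => ?_, ?_, ?_, ?_⟩
  · -- snc POINTWISE
    by_cases hx : x ∈ H'.support
    · -- on the host: the unique prime divisor `P = 𝓘(cl{ζ})` through `x`, then the exchange lemma, then `anti`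
      obtain ⟨ζ, hζ, hζx⟩ := S.exists_divisorialPoint_specializes hx
      have hζ1 : Order.coheight ζ = 1 := ((mem_divisorialPoints_iff H' ζ).mp hζ).2
      set P := primeDivisorIdeal ζ with hPdef
      have hxP : x ∈ P.support := by
        rw [← SetLike.mem_coe, hPdef, coe_support_primeDivisorIdeal]; exact specializes_iff_mem_closure.mp hζx
      have hPcart : IsEffectiveCartier P := isEffectiveCartier_primeDivisorIdeal_of_isRegular S.regW hζ1
      have hPreg : Scheme.IsRegular P.subscheme :=
        DepthOne.isRegular_subscheme_primeDivisorIdeal_of_ne_univ (D := H'.support) S.support_host_ne_univ hDreg hζ1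
          ((mem_divisorialPoints_iff H' ζ).mp hζ).1
      have hPD : stalkIdeal P x = stalkIdeal D x :=
        stalkIdeal_centrePiece_eq hDreg (isPiecePartition_boundaryPieces_of_isRegular hDreg)
          (S.closure_mem_boundaryPieces hζ) (specializes_iff_mem_closure.mp hζx)
      -- the reduced host is snc of one member at `x`
      have hP1 : SNCWithAt [P] ⊤ x := sncWithAt_singleton_of_isRegular_subscheme S.regW hPcart hPreg x
      have hD1 : SNCWithAt [D] ⊤ x :=
        DepthSep.sncWithAt_cons_of_stalkIdeal_eq hP1 hxP hPD.symm (by simp)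
      -- host :: traces, by the exchange lemma
      have hDℬ : SNCWithAt (D :: boundaryOf ℬ') ⊤ x := by
        refine (SNCWithAt.host_cons_transversal (hℬD.sncWithAt x) hD1 le_rfl fun B hB hxB => ⟨hB, ?_⟩).top
        obtain ⟨p, hp, rfl⟩ := List.mem_map.mp hB
        exact S.not_stalkIdeal_le_host hp hxB hx
      -- swap the head to `P`
      have hxD : x ∈ D.support := by
        rw [hDdef, ← SetLike.mem_coe, Scheme.IdealSheafData.coe_support_vanishingIdeal]; exact hx
      have hPℬ : SNCWithAt (P :: boundaryOf ℬ') ⊤ x :=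
        DepthSep.sncWithAt_cons_of_stalkIdeal_eq hDℬ hxD hPD (by
          intro hmem
          -- `D ∈ boundaryOf ℬ'` would put a trace's support onto `Supp H'`
          obtain ⟨p, hp, hpD⟩ := List.mem_map.mp hmem
          refine S.free p hp ?_
          rw [hpD, hDdef, Scheme.IdealSheafData.coe_support_vanishingIdeal])
      -- the other prime divisors miss `x`
      refine hPℬ.anti fun B hB hxB' => ?_
      rcases List.mem_append.mp hB with hB | hB
      · obtain ⟨ζ', hζ', rfl⟩ := hmem𝒮H.mp hB
        have hζ'x : ζ' ⤳ x := by
          rw [specializes_iff_mem_closure, ← coe_support_primeDivisorIdeal]; exact hxB'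
        rw [S.divisorialPoint_unique hDreg hζ' hζ hζ'x hζx]
        exact List.mem_cons_self
      · exact List.mem_cons_of_mem _ hB
    · -- off the host: only traces pass
      refine (S.sncB.sncWithAt x).anti fun B hB hxB' => ?_
      rcases List.mem_append.mp hB with hB | hB
      · obtain ⟨ζ', hζ', rfl⟩ := hmem𝒮H.mp hB
        exfalso
        refine hx ?_
        have hsub : closure ({ζ'} : Set E₁) ⊆ H'.support :=
          closure_minimal (Set.singleton_subset_iff.mpr ((mem_divisorialPoints_iff H' ζ').mp hζ').1) H'.support.isClosed
        rw [← SetLike.mem_coe, coe_support_primeDivisorIdeal] at hxB'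
        exact hsub hxB'
      · exact hB
  · -- members of `𝒮` are in `𝓔₀`, with preconnected supports
    intro p hp
    rcases List.mem_append.mp hp with hp | hp
    · refine ⟨List.mem_append_left _ (List.mem_map.mpr ⟨p, hp, rfl⟩), ?_⟩
      obtain ⟨ζ, -, rfl⟩ := List.mem_map.mp hp
      rw [coe_support_primeDivisorIdeal]
      exact isIrreducible_singleton.closure.isPreirreducible.isPreconnected
    · exact ⟨List.mem_append_right _ (List.mem_map.mpr ⟨p, hp, rfl⟩), (S.irred p hp).isPreirreducible.isPreconnected⟩
  · -- the format's traces are the born traces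
    intro D' hD'
    rw [S.bd] at hD'
    exact Or.inl (List.mem_append_right _ hD')
  · -- the factorisation
    rw [monomialIdeal_append, h𝒮Hmon, S.fac]

end SepCJS

end Summit.ResolutionOfSingularities.ResolutionOfSingularities.Theorems

end
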